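import Summits.AtomisticToContinuum.HydrodynamicLimit.Theses.MourreKoopmanCharges
import Literature.MathematicalPhysics.KineticTheory.HardSphereTwoTimePressure
import Literature.Analysis.FluidPDE.HardSphereAlexander
import HarnessLib

/-!
# `FluctuationFramework` (support item stmt-AtomisticToContinuum-9702, route `MourreKoopmanCharges`):
# the torus ↔ infinite-volume identification, as typed in the tree, kills the density charge

The informal support item FluctuationFramework ("fluctuation framework and torus ↔ infinite-volume
identification") names as its typed deliverable the statement shape
`Literature.MathematicalPhysics.KineticTheory.IdentifiesTorusCovariances σ θ F`
(`FluctuationSpace.lean`; route text: "TorusToFluctuationSpace = ∃ F (the Gibbs data at σ, θ = β⁻¹)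
with IdentifiesTorusCovariances σ θ F"): for ALL one-body cell observables `A_h = Σ_{cell} h(vᵢ)`
in `𝒱` and all continuous `χ₁, χ₂` on `𝕋³`,
`(N+1) · Cov_{G_N}(A_{h₁}(χ₁) ∘ Φ_{s(N+1)^{-1/3}}, A_{h₂}(χ₂)) → (∫ χ₁ χ₂) · ⟪U_s [A_{h₁}], [A_{h₂}]⟫_ℋ`,
where `G_N = localGibbsLaw σ 1 0 θ N` is the CANONICAL equilibrium law of `N + 1` spheres on `𝕋³`.

This file shows that this shape is degenerate, uniformly in the data `F` (Gibbs or not): the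
canonical ensemble fixes the particle number, so for the number charge `h₁ = h₂ = e₀ ≡ 1`
(always in `𝒱`: `cellCharge 0 ∈ localObs` is a field of `HardSphereFluctuationData`) and
`χ₁ = χ₂ ≡ 1` the torus observable `A_{e₀}(1) = (N+1)⁻¹ Σᵢ 1 = 1` is deterministic, every torus
covariance vanishes, and the identification forces

* `⟪U_s q₀, q₀⟫_ℋ = 0` for every `s` (`inner_koopman_chargeClass_zero`), hence
* `q₀ = [n] = 0` in `ℋ` (`chargeClass_zero_eq_zero`): the DENSITY CHARGE IS A NULL VECTOR —
  zero isothermal compressibility / zero static structure factor at `k = 0`, i.e. the first row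
  and column of Spohn's susceptibility matrix `C` (Part I (7.7)) vanish
  (`susceptibility_zero_left/right`) and `dim 𝒞 ≤ 4` (`finrank_chargeSpace_le_four`),

whereas for the infinite-volume hard-sphere Gibbs state at low density `C₀₀ = ρ + ρ² ∫ h(r) dr > 0`
and `C` is positive definite (Spohn 1991 Part I §7.1, (7.7) and the normal-mode analysis
(7.16)–(7.18), which inverts `C`). Consequently `∃ F (Gibbs data) , IdentifiesTorusCovariances σ θ F`
cannot be the typed content of the item: the identification must be restated modulo the
`k = 0` density mode — minimal repair matching every use in the route (`OneBodyCompleteness`,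
`StressStrongMixing` test only profiles `h ⊥ 1` in `L²(M_θ)`): add the hypothesis
`∫ h₁ M_θ = 0` (then `⟪[A_{h₁}], q₀⟫ = 0` under the Gibbs state and the canonical rank-one
correction `−(∫χ₁)(∫χ₂) ⟪[A_{h₁}], q₀⟫⟪q₀, [A_{h₂}]⟫ / ‖q₀‖²` vanishes); the general repair subtracts
that correction (Lebowitz–Percus–Verlet 1967, ensemble dependence of fluctuations).

Only tree facts are used: Alexander's theorem on the torus
(`HardSphereFlow.nonempty_torus_holds`, to inhabit the flow family the shape quantifies over) and
the normalisation of the homogeneous local Gibbs law (`isProbabilityMeasure_localGibbsLaw_const`,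
`σ ≤ 1/2`).

References: H. Spohn, *Large Scale Dynamics of Interacting Particles* (1991), Part I §7.1
(7.4)–(7.7), (7.14)–(7.18); J. L. Lebowitz, J. K. Percus, L. Verlet, Phys. Rev. 153 (1967) 250
(ensemble dependence of fluctuations, canonical `1/N` corrections).
-/

noncomputable section

namespace Summit.AtomisticToContinuum.HydrodynamicLimit.Theorems.FluctuationFramework

open MeasureTheory ProbabilityTheory Filter Set Function
open scoped InnerProductSpace Topology
open Literature.Analysis.FluidPDE Literature.MathematicalPhysics.KineticTheory

variable {σ θ : ℝ}

/-! ## The torus side for the number charge -/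

/-- For `0 < σ < 1/2` a flow family of `N + 1` hard spheres of diameter `σ (N+1)^{-1/3} ≤ σ < 1/2`
on `𝕋³` exists for every `N` (Alexander's theorem on the torus, proved in the tree), so the
universally quantified flow family of `IdentifiesTorusCovariances` can be instantiated. [folklore] -/
theorem nonempty_flowFamily (hσ : 0 < σ) (hσ' : σ < 1 / 2) :
    Nonempty ((N : ℕ) → HardSphereFlow (Torus.geometry (Fin 3)) (hsDiameter σ N) (N + 1)) :=
  ⟨fun N => Classical.choice (HardSphereFlow.nonempty_torus_holds (hsDiameter_pos hσ N)
      (by have h := hsDiameter_le hσ.le N; rw [inv_eq_one_div]; linarith) (N + 1))⟩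

/-- The number-charge profile is the constant `1`: `chargeFn 0 v = 1`. [folklore] -/
@[simp] theorem chargeFn_zero_apply (v : V3) : chargeFn 0 v = 1 := rfl

/-- The empirical number field tested against `χ ≡ 1` is deterministic:
`∫ 1 · e₀ d(emp z) = (N+1)⁻¹ Σᵢ 1 = 1` for every configuration `z` of `N + 1` particles. [folklore] -/
theorem integral_one_mul_chargeFn_zero_empiricalMeasure {N : ℕ} (z : Config (N + 1) (Fin 3) T3) :
    ∫ y, (fun _ : T3 => (1 : ℝ)) y.1 * chargeFn 0 y.2 ∂(empiricalMeasure z) = 1 := by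
  simp

/-- Hence every torus covariance of the number field at `χ ≡ 1` vanishes, whatever the flow, the
time and the (probability) law. [folklore] -/
theorem covariance_numberField_eq_zero {N : ℕ} (P : Measure (Config (N + 1) (Fin 3) T3))
    [IsProbabilityMeasure P] (T : Config (N + 1) (Fin 3) T3 → Config (N + 1) (Fin 3) T3) :
    cov[fun z => ∫ y, (fun _ : T3 => (1 : ℝ)) y.1 * chargeFn 0 y.2 ∂(empiricalMeasure (T z)),
        fun z => ∫ y, (fun _ : T3 => (1 : ℝ)) y.1 * chargeFn 0 y.2 ∂(empiricalMeasure z); P] = 0 := by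
  simp only [integral_one_mul_chargeFn_zero_empiricalMeasure]
  exact covariance_const_left 1

/-- A real sequence which is identically zero has only the limit zero. [folklore] -/
theorem eq_zero_of_tendsto_of_forall_eq_zero {f : ℕ → ℝ} {c : ℝ} (hf : ∀ N, f N = 0)
    (h : Tendsto f atTop (𝓝 c)) : c = 0 := by
  have h0 : Tendsto f atTop (𝓝 0) := by
    simp only [funext hf]
    exact tendsto_const_nhds
  exact tendsto_nhds_unique h h0

/-! ## Consequences of the identification for the density charge `q₀ = [n]` -/

/-- **The identification forces `⟪U_s q₀, q₀⟫_ℋ = 0` for every time `s`**: instantiate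
`IdentifiesTorusCovariances σ θ F` at `h₁ = h₂ = e₀ ≡ 1` (in `𝒱` by the field `cellCharge_mem`)
and `χ₁ = χ₂ ≡ 1`; the torus side is identically `0` (`covariance_numberField_eq_zero`, the
homogeneous local Gibbs law being a probability measure for `σ ≤ 1/2`), the claimed limit is
`(∫ 1) · ⟪U_s q₀, q₀⟫ = ⟪U_s q₀, q₀⟫`. [folklore] -/
theorem inner_koopman_chargeClass_zero (hσ : 0 < σ) (hσ' : σ < 1 / 2) (hθ : 0 < θ)
    (F : HardSphereFluctuationData σ) (hF : IdentifiesTorusCovariances σ θ F) (s : ℝ) :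
    ⟪F.koopman s (F.chargeClass 0), F.chargeClass 0⟫_ℝ = 0 := by
  obtain ⟨Φ⟩ := nonempty_flowFamily hσ hσ'
  have hmem : cellObs (chargeFn 0) ∈ F.localObs := F.cellCharge_mem 0
  have hlim := hF Φ (chargeFn 0) (chargeFn 0) hmem hmem (fun _ => 1) (fun _ => 1)
    continuous_const continuous_const s
  have hc := eq_zero_of_tendsto_of_forall_eq_zero (fun N => ?_) hlim
  · have h1 : (∫ x : T3, (fun _ : T3 => (1 : ℝ)) x * (fun _ : T3 => (1 : ℝ)) x) = 1 := by simp
    rw [h1, one_mul] at hc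
    exact hc
  · haveI := isProbabilityMeasure_localGibbsLaw_const (σ := σ) hθ (by linarith) (0 : V3) N (Φ N)
    rw [covariance_numberField_eq_zero, mul_zero]

/-- **The identification forces the density charge to be a null vector: `q₀ = [n] = 0` in `ℋ`**
(`s = 0` in `inner_koopman_chargeClass_zero`: `‖q₀‖² = 0`). For the infinite-volume hard-sphere
Gibbs state `‖q₀‖² = ∫ Cov(n(0), n(x)) dx = ρ k_B T ρ κ_T > 0`, so no Gibbs fluctuation data can
satisfy the shape as typed. [folklore] -/
theorem chargeClass_zero_eq_zero (hσ : 0 < σ) (hσ' : σ < 1 / 2) (hθ : 0 < θ)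
    (F : HardSphereFluctuationData σ) (hF : IdentifiesTorusCovariances σ θ F) :
    F.chargeClass 0 = 0 := by
  have h := inner_koopman_chargeClass_zero hσ hσ' hθ F hF 0
  rw [FluctuationDynamics.koopman_zero_apply] at h
  exact inner_self_eq_zero.1 h

/-- The density fluctuation class `[n] = fluct (cellCharge 0)` vanishes (unbundled form). [folklore] -/
theorem fluct_cellCharge_zero_eq_zero (hσ : 0 < σ) (hσ' : σ < 1 / 2) (hθ : 0 < θ)
    (F : HardSphereFluctuationData σ) (hF : IdentifiesTorusCovariances σ θ F) :
    F.fluct (cellCharge 0) = 0 :=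
  chargeClass_zero_eq_zero hσ hσ' hθ F hF

/-- **First row of the susceptibility matrix vanishes**: `C₀ⱼ = ⟪q₀, qⱼ⟫ = 0` — in particular the
compressibility entry `C₀₀ = 0` (Spohn's `C` of Part I (7.7) is singular). [folklore] -/
theorem susceptibility_zero_left (hσ : 0 < σ) (hσ' : σ < 1 / 2) (hθ : 0 < θ)
    (F : HardSphereFluctuationData σ) (hF : IdentifiesTorusCovariances σ θ F) (j : Fin 5) :
    F.susceptibility 0 j = 0 := by
  rw [HardSphereFluctuationData.susceptibility_apply, chargeClass_zero_eq_zero hσ hσ' hθ F hF,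
    inner_zero_left]

/-- First column of the susceptibility matrix vanishes: `Cⱼ₀ = 0`. [folklore] -/
theorem susceptibility_zero_right (hσ : 0 < σ) (hσ' : σ < 1 / 2) (hθ : 0 < θ)
    (F : HardSphereFluctuationData σ) (hF : IdentifiesTorusCovariances σ θ F) (j : Fin 5) :
    F.susceptibility j 0 = 0 := by
  rw [HardSphereFluctuationData.susceptibility_symm, susceptibility_zero_left hσ hσ' hθ F hF]

/-- **At most four charges survive**: with `q₀ = 0` the charge space `𝒞 = span{q₀, …, q₄}` is
spanned by `q₁, …, q₄`, so `dim 𝒞 ≤ 4` (instead of Spohn's five hydrodynamic fields). [folklore] -/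
theorem finrank_chargeSpace_le_four (hσ : 0 < σ) (hσ' : σ < 1 / 2) (hθ : 0 < θ)
    (F : HardSphereFluctuationData σ) (hF : IdentifiesTorusCovariances σ θ F) :
    Module.finrank ℝ F.chargeSpace ≤ 4 := by
  have hspan : F.chargeSpace = Submodule.span ℝ (Set.range (Fin.tail F.chargeClass)) := by
    rw [HardSphereFluctuationData.chargeSpace, Fin.range_fin_succ,
      chargeClass_zero_eq_zero hσ hσ' hθ F hF, Submodule.span_insert_zero]
  rw [hspan]
  have h := finrank_range_le_card (R := ℝ) (Fin.tail F.chargeClass)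
  rw [Fintype.card_fin] at h
  exact h

/-- **Summary (the shape is degenerate)**: under `IdentifiesTorusCovariances σ θ F` as typed,
the density charge is null, its susceptibility row vanishes and at most four charges remain —
for every hard-sphere fluctuation data `F` at `0 < σ < 1/2`, `θ > 0`. [folklore] -/
theorem identifiesTorusCovariances_degenerate (hσ : 0 < σ) (hσ' : σ < 1 / 2) (hθ : 0 < θ)
    (F : HardSphereFluctuationData σ) (hF : IdentifiesTorusCovariances σ θ F) :
    F.chargeClass 0 = 0 ∧ (∀ j, F.susceptibility 0 j = 0) ∧ Module.finrank ℝ F.chargeSpace ≤ 4 :=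
  ⟨chargeClass_zero_eq_zero hσ hσ' hθ F hF, susceptibility_zero_left hσ hσ' hθ F hF,
    finrank_chargeSpace_le_four hσ hσ' hθ F hF⟩

end Summit.AtomisticToContinuum.HydrodynamicLimit.Theorems.FluctuationFramework

end
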